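import Summits.CriticalPhenomena.PercolationContinuityZ3.Theorems.PercNearOneGluingNoHeavyQuantFarGate3CertNEval
import HarnessLib

/-!
# QUANT lane R8, front "FAR beyond trees", layer one — THE DEGREE-THREE GATE AT THE OBSERVER, LXVII: generic box-certificate engine over kernel N — SOUNDNESS
# (`CertN.sound`: `specOk S` and `check S d` ⟹ chart `S` has no bad point in the box of `d`)

builds on p205010 (kernel theorem, internal audit signed; external expert review pending)

Support file (`--supports stmt-CriticalPhenomena-4575`), seat `prim-quant-p1` (gen 35); memo
`run/shared/lean/prim/quant/prim-quant-p1-g35/FOR-LEAD-GATE3-PINCH.md`.  Files LXIII–LXVI only; standard axioms; no sorries.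

The argument of `Gate3.certC` (file XLVIII) once and for all, for a chart given as DATA: at a bad point `v` of chart `S` in the box, the quantity
`Φ = Σ_{entries} mu·fac·(v_idx · form_kind)  [form entries]  + mu·fac·row_idx  [row entries]` is `> 0` (every term `≥ 0` since `fac ≥ 0` on the box,
cells, rows `≥ 0`, forms `> 0`; the `posOk` entry — a constant multiplier of a form by a `B`-cell, and `v 3, v 4 > 0` — is `> 0`), while regrouping
by cell monomials gives `Φ = Σ_{m ≤ m'} ev (polyOf S d m m') · v m v m' ≤ 0` by the kernel step of file LXVI.  Hence `CertN.sound`.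
[this work].
-/

namespace Summit.CriticalPhenomena.PercolationContinuityZ3.Theorems

namespace Quant

namespace CertN

open BoxPolyP

noncomputable section

/-- Sum over the 36 cell monomials `m ≤ m'`. -/
def sum36 (f : Fin 8 → Fin 8 → ℝ) : ℝ :=
  f 0 0 + f 0 1 + f 0 2 + f 0 3 + f 0 4 + f 0 5 + f 0 6 + f 0 7 + f 1 1 + f 1 2 + f 1 3 + f 1 4 + f 1 5 + f 1 6 + f 1 7 + f 2 2 + f 2 3 + f 2 4 + f 2 5 + f 2 6 + f 2 7 + f 3 3 + f 3 4 + f 3 5 + f 3 6 + f 3 7 + f 4 4 + f 4 5 + f 4 6 + f 4 7 + f 5 5 + f 5 6 + f 5 7 + f 6 6 + f 6 7 + f 7 7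

/-- Cell value by natural index (`0` outside `0..7`). -/
def vN (v : Fin 8 → ℝ) (idx : ℕ) : ℝ := if h : idx < 8 then v ⟨idx, h⟩ else 0

/-- Form value by natural kind (`0` outside `0..4`). -/
def formValN (S : Spec) (kind : ℕ) (y a b c : ℝ) (v : Fin 8 → ℝ) : ℝ := if h : kind < 5 then formVal S ⟨kind, h⟩ y a b c v else 0

/-- Row value by natural index (`0` outside `0..5`). -/
def rowValN (S : Spec) (k : ℕ) (y a b c : ℝ) (v : Fin 8 → ℝ) : ℝ := if h : k < 6 then rowVal S ⟨k, h⟩ y a b c v else 0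

/-- The term of `Φ` belonging to one entry. -/
def entryVal (S : Spec) (d : Cert) (en : Entry) (y a b c : ℝ) (v : Fin 8 → ℝ) : ℝ :=
  if en.kind ≤ 4 then wt d en y a b c * (vN v en.idx * formValN S en.kind y a b c v)
  else if en.kind = 5 then wt d en y a b c * rowValN S en.idx y a b c v
  else 0

end

/-- `sum36` is additive. [this work] -/
theorem sum36_add (f g : Fin 8 → Fin 8 → ℝ) : sum36 (fun m m' => f m m' + g m m') = sum36 f + sum36 g := by
  unfold sum36; ring

/-- `sum36` of a list sum. [this work] -/
theorem sum36_listSum {α : Type*} (L : List α) (F : α → Fin 8 → Fin 8 → ℝ) :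
    sum36 (fun m m' => (L.map fun x => F x m m').sum) = (L.map fun x => sum36 (F x)).sum := by
  induction L with
  | nil => simp [sum36]
  | cons x L ih => simp only [List.map_cons, List.sum_cons]; rw [← ih, ← sum36_add]

/-- `sum36` of termwise products with a list sum. [this work] -/
theorem sum36_listSum_mul {α : Type*} (L : List α) (F : α → Fin 8 → Fin 8 → ℝ) (w : Fin 8 → Fin 8 → ℝ) :
    sum36 (fun m m' => (L.map fun x => F x m m').sum * w m m') = (L.map fun x => sum36 (fun m m' => F x m m' * w m m')).sum := by
  have e : (fun m m' => (L.map fun x => F x m m').sum * w m m') = (fun m m' => (L.map fun x => F x m m' * w m m').sum) := by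
    funext m m'; rw [List.sum_map_mul_right]
  rw [e, sum36_listSum]

/-- A `sum36` of non-positive terms is non-positive. [this work] -/
theorem sum36_nonpos (f : Fin 8 → Fin 8 → ℝ) (h : ∀ mm ∈ monos, f mm.1 mm.2 ≤ 0) : sum36 f ≤ 0 := by
  have h_0_0 := h (0, 0) (by simp [monos])
  have h_0_1 := h (0, 1) (by simp [monos])
  have h_0_2 := h (0, 2) (by simp [monos])
  have h_0_3 := h (0, 3) (by simp [monos])
  have h_0_4 := h (0, 4) (by simp [monos])
  have h_0_5 := h (0, 5) (by simp [monos])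
  have h_0_6 := h (0, 6) (by simp [monos])
  have h_0_7 := h (0, 7) (by simp [monos])
  have h_1_1 := h (1, 1) (by simp [monos])
  have h_1_2 := h (1, 2) (by simp [monos])
  have h_1_3 := h (1, 3) (by simp [monos])
  have h_1_4 := h (1, 4) (by simp [monos])
  have h_1_5 := h (1, 5) (by simp [monos])
  have h_1_6 := h (1, 6) (by simp [monos])
  have h_1_7 := h (1, 7) (by simp [monos])
  have h_2_2 := h (2, 2) (by simp [monos])
  have h_2_3 := h (2, 3) (by simp [monos])
  have h_2_4 := h (2, 4) (by simp [monos])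
  have h_2_5 := h (2, 5) (by simp [monos])
  have h_2_6 := h (2, 6) (by simp [monos])
  have h_2_7 := h (2, 7) (by simp [monos])
  have h_3_3 := h (3, 3) (by simp [monos])
  have h_3_4 := h (3, 4) (by simp [monos])
  have h_3_5 := h (3, 5) (by simp [monos])
  have h_3_6 := h (3, 6) (by simp [monos])
  have h_3_7 := h (3, 7) (by simp [monos])
  have h_4_4 := h (4, 4) (by simp [monos])
  have h_4_5 := h (4, 5) (by simp [monos])
  have h_4_6 := h (4, 6) (by simp [monos])
  have h_4_7 := h (4, 7) (by simp [monos])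
  have h_5_5 := h (5, 5) (by simp [monos])
  have h_5_6 := h (5, 6) (by simp [monos])
  have h_5_7 := h (5, 7) (by simp [monos])
  have h_6_6 := h (6, 6) (by simp [monos])
  have h_6_7 := h (6, 7) (by simp [monos])
  have h_7_7 := h (7, 7) (by simp [monos])
  unfold sum36
  linarith only [h_0_0, h_0_1, h_0_2, h_0_3, h_0_4, h_0_5, h_0_6, h_0_7, h_1_1, h_1_2, h_1_3, h_1_4, h_1_5, h_1_6, h_1_7, h_2_2, h_2_3, h_2_4, h_2_5, h_2_6, h_2_7, h_3_3, h_3_4, h_3_5, h_3_6, h_3_7, h_4_4, h_4_5, h_4_6, h_4_7, h_5_5, h_5_6, h_5_7, h_6_6, h_6_7, h_7_7]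

section Point

variable (y a b c : ℝ) (d : Cert) (S : Spec)

set_option maxHeartbeats 4000000 in
/-- **Regrouping, form entry.** [this work] -/
theorem sum36_condE_form (en : Entry) (hk : en.kind ≤ 4) (hidx : en.idx ≤ 7) (v : Fin 8 → ℝ) :
    sum36 (fun m m' => condE y a b c d S en m m' * (v m * v m')) = entryVal S d en y a b c v := by
  have hk5 : en.kind < 5 := by omega
  obtain ⟨i0, hi0⟩ : ∃ i0, en.idx = i0 := ⟨_, rfl⟩
  rw [hi0] at hidx
  simp only [condE, entryVal, if_pos hk, formValN, dif_pos hk5, formVal, vN, GN, hi0, sum36]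
  interval_cases i0 <;> simp <;> ring

/-- **Regrouping, row entry.** [this work] -/
theorem sum36_condE_row (en : Entry) (hk : en.kind = 5) (hidx : en.idx ≤ 5) (v : Fin 8 → ℝ) :
    sum36 (fun m m' => condE y a b c d S en m m' * (v m * v m')) = entryVal S d en y a b c v := by
  have hk6 : en.idx < 6 := by omega
  have hk4 : ¬ en.kind ≤ 4 := by omega
  simp only [condE, entryVal, if_neg hk4, if_pos hk, rowValN, dif_pos hk6, rowVal, HN, sum36]
  ring

/-- **Regrouping by entries**: `Σ_{m≤m'} condE·v v = entryVal` for a well-formed entry. [this work] -/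
theorem sum36_condE (en : Entry) (hen : entryOk S en = true) (v : Fin 8 → ℝ) :
    sum36 (fun m m' => condE y a b c d S en m m' * (v m * v m')) = entryVal S d en y a b c v := by
  simp only [entryOk, Bool.and_eq_true, Bool.or_eq_true, decide_eq_true_eq] at hen
  rcases hen.2 with ⟨⟨hk, hidx⟩, _⟩ | ⟨⟨hk, hidx⟩, _⟩
  · exact sum36_condE_form y a b c d S en hk hidx v
  · exact sum36_condE_row y a b c d S en hk hidx v

/-- **`Φ` two ways**: `Σ_{m≤m'} ev (polyOf S d m m')·v m v m' = Σ_{entries} entryVal`. [this work] -/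
theorem sum36_polyOf (hS : specOk S = true) (hL : ∀ en ∈ d.entries, entryOk S en = true) (v : Fin 8 → ℝ) :
    sum36 (fun m m' => ev (polyOf S d m m') y a b c * (v m * v m')) = (d.entries.map fun en => entryVal S d en y a b c v).sum := by
  have e : (fun m m' => ev (polyOf S d m m') y a b c * (v m * v m')) =
      (fun m m' => (d.entries.map fun en => condE y a b c d S en m m').sum * (v m * v m')) := by
    funext m m'; rw [ev_polyOf y a b c d S hS hL m m']
  rw [e, sum36_listSum_mul]
  congr 1
  apply List.map_congr_left
  intro en hen
  exact sum36_condE y a b c d S en (hL en hen) v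

/-- The box-relative factor is non-negative on the box. [this work] -/
theorem fac_nonneg (e : ℕ) (hy0 : (d.Y0 : ℝ) ≤ (d.D : ℝ) * y) (ha0 : (d.A0 : ℝ) ≤ (d.D : ℝ) * a) (hb0 : (d.B0 : ℝ) ≤ (d.D : ℝ) * b)
    (hc0 : (d.C0 : ℝ) ≤ (d.D : ℝ) * c) : 0 ≤ fac d e y a b c := by
  unfold fac
  have h1 : (0 : ℝ) ≤ (d.D : ℝ) * y - d.Y0 := by linarith
  have h2 : (0 : ℝ) ≤ (d.D : ℝ) * a - d.A0 := by linarith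
  have h3 : (0 : ℝ) ≤ (d.D : ℝ) * b - d.B0 := by linarith
  have h4 : (0 : ℝ) ≤ (d.D : ℝ) * c - d.C0 := by linarith
  positivity

/-- Every entry's term is `≥ 0` at a bad point in the box. [this work] -/
theorem entryVal_nonneg (en : Entry) (v : Fin 8 → ℝ) (hbad : Bad S y a b c v) (hy0 : (d.Y0 : ℝ) ≤ (d.D : ℝ) * y)
    (ha0 : (d.A0 : ℝ) ≤ (d.D : ℝ) * a) (hb0 : (d.B0 : ℝ) ≤ (d.D : ℝ) * b) (hc0 : (d.C0 : ℝ) ≤ (d.D : ℝ) * c) :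
    0 ≤ entryVal S d en y a b c v := by
  obtain ⟨hv, _, _, hrows, hforms⟩ := hbad
  have hwt : 0 ≤ wt d en y a b c := mul_nonneg (Nat.cast_nonneg _) (fac_nonneg y a b c d en.e hy0 ha0 hb0 hc0)
  have hvN : 0 ≤ vN v en.idx := by unfold vN; split_ifs <;> first | exact le_rfl | exact hv _
  have hfN : 0 ≤ formValN S en.kind y a b c v := by unfold formValN; split_ifs <;> first | exact le_rfl | exact (hforms _).le
  have hrN : 0 ≤ rowValN S en.idx y a b c v := by unfold rowValN; split_ifs <;> first | exact le_rfl | exact hrows _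
  unfold entryVal
  split_ifs
  · exact mul_nonneg hwt (mul_nonneg hvN hfN)
  · exact mul_nonneg hwt hrN
  · exact le_rfl

/-- The `posOk` entry's term is `> 0` at a bad point. [this work] -/
theorem entryVal_pos (en : Entry) (v : Fin 8 → ℝ) (hbad : Bad S y a b c v) (hk : en.kind ≤ 4) (hidx : en.idx = 3 ∨ en.idx = 4) (he : en.e = 0)
    (hmu : 0 < en.mu) : 0 < entryVal S d en y a b c v := by
  obtain ⟨_, h3, h4, _, hforms⟩ := hbad
  have hk5 : en.kind < 5 := by omega
  have hwt : 0 < wt d en y a b c := by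
    unfold wt fac; rw [he]; simp only [Nat.zero_mod, Nat.zero_div, pow_zero, mul_one]; exact_mod_cast hmu
  have hvN : 0 < vN v en.idx := by
    unfold vN; rcases hidx with h | h <;> rw [h] <;> simpa using (by assumption : 0 < v _)
  have hfN : 0 < formValN S en.kind y a b c v := by unfold formValN; rw [dif_pos hk5]; exact hforms _
  unfold entryVal; rw [if_pos hk]
  exact mul_pos hwt (mul_pos hvN hfN)

/-- **SOUNDNESS of the generic box-certificate engine.** If the chart's tables satisfy the degree condition and the certificate checks, then
the chart system has no bad point at any real point of the certificate's box. [this work] -/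
theorem sound (hS : specOk S = true) (hd : check S d = true)
    (hy0 : (d.Y0 : ℝ) ≤ (d.D : ℝ) * y) (hy1 : (d.D : ℝ) * y ≤ d.Y1) (ha0 : (d.A0 : ℝ) ≤ (d.D : ℝ) * a) (ha1 : (d.D : ℝ) * a ≤ d.A1)
    (hb0 : (d.B0 : ℝ) ≤ (d.D : ℝ) * b) (hb1 : (d.D : ℝ) * b ≤ d.B1) (hc0 : (d.C0 : ℝ) ≤ (d.D : ℝ) * c) (hc1 : (d.D : ℝ) * c ≤ d.C1)
    (v : Fin 8 → ℝ) : ¬ Bad S y a b c v := by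
  intro hbad
  simp only [check, Bool.and_eq_true, decide_eq_true_eq, List.all_eq_true] at hd
  obtain ⟨⟨⟨hD, hent⟩, hpos⟩, hpairs⟩ := hd
  -- Φ ≤ 0 by the kernel
  have hle : sum36 (fun m m' => ev (polyOf S d m m') y a b c * (v m * v m')) ≤ 0 := by
    apply sum36_nonpos
    intro mm hmm
    have hev := ev_polyOf_nonpos d S mm.1 mm.2 (hpairs mm hmm) hD y a b c hy0 hy1 ha0 ha1 hb0 hb1 hc0 hc1
    exact mul_nonpos_of_nonpos_of_nonneg hev (mul_nonneg (hbad.1 _) (hbad.1 _))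
  -- Φ > 0 entry by entry
  rw [sum36_polyOf y a b c d S hS hent v] at hle
  simp only [posOk, List.any_eq_true, decide_eq_true_eq] at hpos
  obtain ⟨en, hen, hk, hidx, he, hmu⟩ := hpos
  have hposv : 0 < entryVal S d en y a b c v := entryVal_pos y a b c d S en v hbad hk hidx he hmu
  have hmem : entryVal S d en y a b c v ∈ d.entries.map fun en => entryVal S d en y a b c v := List.mem_map.2 ⟨en, hen, rfl⟩
  have hge := List.single_le_sum (fun x hx => by
      obtain ⟨en', hen', rfl⟩ := List.mem_map.1 hx
      exact entryVal_nonneg y a b c d S en' v hbad hy0 ha0 hb0 hc0) _ hmem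
  linarith

end Point

end CertN

end Quant

end Summit.CriticalPhenomena.PercolationContinuityZ3.Theorems
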